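import Mathlib
import Literature.Computability.AlgebraicComplexity.AlgDetRepr
import HarnessLib

/-!
# Shallow coefficient algebras semisimplify — the depth axis of `PolySizeQPAlgebra`

Helper file for the piece `PolySizeQPAlgebra` (stmt-ValiantsHypothesis-8064, line `vbp-slice-dealg`)
of route `GrenetZeon`.  The piece excludes `(m, s)`-representations of `per_n` — `per_n = λ(det A)`
coefficientwise, `A` an `m × m` matrix of affine forms over a commutative `ℂ`-algebra `R` of
dimension `s`, `λ : R → ℂ` linear — in the box `m ≤ n^c + c`, `s ≤ 2^((log₂ n + c)^c)`.  Its
registered stubs (`stub_vbpSlice` = `VNP ⊄ VBP` a.e., `stub_dealgebraizePoly`) are open problems;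
this file decides the piece along a new axis, the LOEWY DEPTH of the coefficient algebra.

## Main results

* `det_of_sum_mul_rows` — row polarization of the determinant (multilinearity in the rows).
* `eq_sum_dets_of_depth` — **semisimplification.**  If `R` carries a character `φ : R → k` with
  `(ker φ)^ν = 0` (a local algebra of Loewy depth `≤ ν`: dual numbers `ν = 2`; the zeon algebra on
  `n` generators `ν = n + 1`) and `f = λ(det A)` for an affine `m × m` matrix `A` over `R`, then
  `f = Σ_{q<G} α_q det B_q` with AFFINE `m × m` matrices `B_q` over `k` ITSELF and
  `G ≤ Σ_{j<ν} C(m·g, j)`, `g = dim ker φ = dim R - 1`.  Proof: expand each row of `A` in augmented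
  coordinates `R = k·1 ⊕ ker φ`, use multilinearity of `det` in the rows, and discard the choice
  functions taking `≥ ν` kernel coordinates — their coefficient lies in `λ((ker φ)^ν) = 0`.  Exact
  and valid over every field (the commutative-coefficient counterpart of Bini's 1980
  de-approximation of border computations, with polarization in place of interpolation).
* `eq_sum_dets_of_depth_le` — the clean count `G ≤ (m (s - 1) + 1)^(ν - 1)` for `dim R ≤ s`.
  Depth `2`: an `(m, s)`-representation over a square-zero augmented algebra is a sum of
  `m (s - 1) + 1` determinants of size `m` (for dual numbers: `per_n = α det A + β tr(adj A · A′)`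
  is a sum of `m + 1` affine determinants of size `m`).
* This file is route-independent (no `Theses` import).  The packaging as an
  `(m, G)`-representation over the split semisimple algebra and the application to the box of the
  piece (polylog depth is excluded by the ΣDet rung `not_sum_dets_of_polySizeQPAlgebra`) are in the
  companion file `GrenetZeonPolySizeQPAlgebraDepthAxis.lean`.

No stub of the line is closed; `VP ≠ VNP` is not touched.

## References

* P. Hrubeš, A. Yehudayoff, *Arithmetic complexity in ring extensions*, Theory of Computing 7
  (2011), §2 (the dimension parameter of a coefficient extension). [cite: HrubesYehudayoff2011, §2]
* D. Bini, *Relations between exact and approximate bilinear algorithms*, Calcolo 17 (1980)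
  (de-approximation by interpolation; here replaced by exact polarization).
-/

set_option linter.dupNamespace false

noncomputable section

namespace Summit.ValiantsHypothesis.ValiantsHypothesis.Theorems.GrenetZeonPolySizeQPAlgebra

open MvPolynomial Matrix
open Literature.Computability.AlgebraicComplexity

universe u v

section RowExpansion

variable {S : Type*} [CommRing S]

/-- **Row polarization of the determinant.** If every row of a matrix is the same linear
combination pattern `row_i = Σ_o w_o · (B_o)_i` of the rows of matrices `B_o`, then by
multilinearity of `det` in the rows, `det = Σ_c (∏_i w_{c i}) · det (row i from B_{c i})`, the sum
over all choice functions `c : Fin m → O`. [folklore] -/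
theorem det_of_sum_mul_rows {m : ℕ} {O : Type*} [Fintype O] (w : O → S)
    (B : O → Matrix (Fin m) (Fin m) S) :
    (Matrix.of fun i j => ∑ o, w o * B o i j).det =
      ∑ c : Fin m → O, (∏ i, w (c i)) * (Matrix.of fun i j => B (c i) i j).det := by
  classical
  have h1 : (Matrix.of fun i j => ∑ o, w o * B o i j) = fun i => ∑ o, w o • B o i := by
    ext i j
    simp only [Matrix.of_apply, Finset.sum_apply, Pi.smul_apply, smul_eq_mul]
  have key := MultilinearMap.map_sum
    ((Matrix.detRowAlternating : (Fin m → S) [⋀^Fin m]→ₗ[S] S).toMultilinearMap)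
    (fun i o => w o • B o i)
  simp only [AlternatingMap.coe_multilinearMap] at key
  rw [h1]
  change Matrix.detRowAlternating (fun i => ∑ o, w o • B o i) = _
  rw [key]
  refine Finset.sum_congr rfl fun c _ => ?_
  rw [AlternatingMap.map_smul_univ, smul_eq_mul]
  rfl

end RowExpansion

section Counting

/-- The graph of a partial choice function `c : Fin m → Option (Fin g)`: the pairs `(i, x)` with
`c i = some x`. [folklore] -/
theorem mem_graphFinset_iff {m g : ℕ} (c : Fin m → Option (Fin g)) (p : Fin m × Fin g) :
    p ∈ (Finset.univ.filter fun q : Fin m × Fin g => c q.1 = some q.2) ↔ c p.1 = some p.2 := by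
  simp only [Finset.mem_filter, Finset.mem_univ, true_and]

/-- A partial choice function is determined by its graph. [folklore] -/
theorem graphFinset_injective (m g : ℕ) :
    Function.Injective fun c : Fin m → Option (Fin g) =>
      (Finset.univ.filter fun q : Fin m × Fin g => c q.1 = some q.2) := by
  intro c c' h
  funext i
  have key : ∀ x, c i = some x ↔ c' i = some x := fun x => by
    have := congrArg (fun T : Finset (Fin m × Fin g) => ((i, x) ∈ T)) h
    simpa only [mem_graphFinset_iff, eq_iff_iff] using this
  cases hci : c i with
  | some x => exact ((key x).mp hci).symm
  | none =>
    cases hci' : c' i with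
    | none => rfl
    | some y => exact absurd ((key y).mpr hci') (by rw [hci]; simp)

/-- The support of a partial choice function has the cardinality of its graph. [folklore] -/
theorem card_support_eq_card_graphFinset {m g : ℕ} (c : Fin m → Option (Fin g)) :
    (Finset.univ.filter fun i : Fin m => c i ≠ none).card =
      (Finset.univ.filter fun q : Fin m × Fin g => c q.1 = some q.2).card := by
  classical
  set T := (Finset.univ.filter fun q : Fin m × Fin g => c q.1 = some q.2) with hT
  have himage : T.image Prod.fst = (Finset.univ.filter fun i : Fin m => c i ≠ none) := by
    ext i
    simp only [Finset.mem_image, Finset.mem_filter, Finset.mem_univ, true_and, hT, Prod.exists,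
      exists_and_right, exists_eq_right]
    constructor
    · rintro ⟨x, hx⟩
      rw [hx]
      exact Option.some_ne_none x
    · intro h
      obtain ⟨x, hx⟩ := Option.ne_none_iff_exists'.mp h
      exact ⟨x, hx⟩
  have hinj : Set.InjOn Prod.fst (T : Set (Fin m × Fin g)) := by
    rintro ⟨i, x⟩ hx ⟨i', x'⟩ hx' (hii' : i = i')
    simp only [Finset.mem_coe, hT, mem_graphFinset_iff] at hx hx'
    subst hii'
    rw [hx] at hx'
    cases hx'
    rfl
  rw [← himage, Finset.card_image_of_injOn hinj]

/-- Counting partial choice functions with fewer than `ν` values: at most `Σ_{j<ν} C(m g, j)`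
(inject by the graph into the subsets of `Fin m × Fin g` of size `< ν`). [folklore] -/
theorem card_shallowChoices_le (m g ν : ℕ) :
    (Finset.univ.filter fun c : Fin m → Option (Fin g) =>
        (Finset.univ.filter fun q : Fin m × Fin g => c q.1 = some q.2).card < ν).card ≤
      ∑ j ∈ Finset.range ν, (m * g).choose j := by
  classical
  set P : Finset (Finset (Fin m × Fin g)) :=
    Finset.univ.filter fun T : Finset (Fin m × Fin g) => T.card < ν with hP
  have h1 : (Finset.univ.filter fun c : Fin m → Option (Fin g) =>
        (Finset.univ.filter fun q : Fin m × Fin g => c q.1 = some q.2).card < ν).card ≤ P.card := by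
    refine Finset.card_le_card_of_injOn
      (fun c => Finset.univ.filter fun q : Fin m × Fin g => c q.1 = some q.2) ?_ ?_
    · intro c hc
      simp only [Finset.coe_filter, Finset.mem_univ, true_and, Set.mem_setOf_eq] at hc
      simp only [hP, Finset.coe_filter, Finset.mem_univ, true_and, Set.mem_setOf_eq]
      exact hc
    · exact (graphFinset_injective m g).injOn
  have h2 : P ⊆ (Finset.range ν).biUnion fun j => Finset.powersetCard j Finset.univ := by
    intro T hT
    simp only [hP, Finset.mem_filter, Finset.mem_univ, true_and] at hT
    simp only [Finset.mem_biUnion, Finset.mem_range, Finset.mem_powersetCard]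
    exact ⟨T.card, hT, Finset.subset_univ T, rfl⟩
  have h3 : ((Finset.range ν).biUnion fun j =>
      Finset.powersetCard j (Finset.univ : Finset (Fin m × Fin g))).card ≤
      ∑ j ∈ Finset.range ν, (m * g).choose j := by
    refine Finset.card_biUnion_le.trans (Finset.sum_le_sum fun j _ => ?_)
    rw [Finset.card_powersetCard, Finset.card_univ, Fintype.card_prod, Fintype.card_fin,
      Fintype.card_fin]
  exact h1.trans ((Finset.card_le_card h2).trans h3)

/-- `Σ_{j<ν} C(N, j) ≤ (N + 1)^(ν - 1)`. [folklore] -/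
theorem sum_range_choose_le_pow (N ν : ℕ) :
    ∑ j ∈ Finset.range ν, N.choose j ≤ (N + 1) ^ (ν - 1) := by
  cases ν with
  | zero => simp
  | succ t =>
    simp only [Nat.add_sub_cancel]
    induction t with
    | zero => simp
    | succ t ih =>
      rw [Finset.sum_range_succ, pow_succ]
      have h1 : N.choose (t + 1) ≤ N * (N + 1) ^ t := by
        calc N.choose (t + 1) ≤ N ^ (t + 1) := Nat.choose_le_pow N (t + 1)
          _ = N * N ^ t := by rw [pow_succ, mul_comm]
          _ ≤ N * (N + 1) ^ t := Nat.mul_le_mul_left N (Nat.pow_le_pow_left (Nat.le_succ N) t)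
      calc ∑ j ∈ Finset.range (t + 1), N.choose j + N.choose (t + 1)
          ≤ (N + 1) ^ t + N * (N + 1) ^ t := Nat.add_le_add ih h1
        _ = (N + 1) ^ t * (N + 1) := by ring

end Counting

section Semisimplification

variable {k : Type u} [Field k] {σ : Type v}

/-- Coefficients of a coordinate functional applied coefficientwise. [folklore] -/
theorem coeff_mapCoord {R : Type u} [CommRing R] [Algebra k R] (π : R →ₗ[k] k)
    (p : MvPolynomial σ R) (d : σ →₀ ℕ) :
    coeff d (AddMonoidAlgebra.map π.toAddMonoidHom p : MvPolynomial σ k) = π (coeff d p) := rfl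

/-- A coordinate functional applied coefficientwise does not raise the total degree (the support
shrinks). [folklore] -/
theorem totalDegree_mapCoord_le {R : Type u} [CommRing R] [Algebra k R] (π : R →ₗ[k] k)
    (p : MvPolynomial σ R) :
    MvPolynomial.totalDegree (AddMonoidAlgebra.map π.toAddMonoidHom p : MvPolynomial σ k) ≤
      p.totalDegree := by
  refine Finset.sup_le fun d hd => ?_
  have hd' : d ∈ p.support := by
    rw [mem_support_iff] at hd ⊢
    intro h
    apply hd
    rw [coeff_mapCoord, h, map_zero]
  exact le_totalDegree hd'

/-- **Augmented coordinates.** For a character `φ` of a finite-dimensional commutative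
`k`-algebra `R`, `R = k·1 ⊕ ker φ`: there are `w₀ = 1` and a basis `w₁, …, w_g` of `ker φ`
(`g = finrank (ker φ)`), with `k`-linear coordinate functionals `π_o`, such that
`r = Σ_o π_o(r) · w_o` for every `r`. [folklore] -/
theorem exists_augmentedCoords {R : Type u} [CommRing R] [Algebra k R] [Module.Finite k R]
    (φ : R →ₐ[k] k) :
    ∃ (g : ℕ) (_ : g = Module.finrank k (LinearMap.ker φ.toLinearMap))
      (w : Option (Fin g) → R) (π : Option (Fin g) → (R →ₗ[k] k)),
      w none = 1 ∧ (∀ i, φ (w (some i)) = 0) ∧ ∀ r : R, ∑ o, π o r • w o = r := by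
  let bK := Module.finBasis k (LinearMap.ker φ.toLinearMap)
  have hmem : ∀ r : R, r - algebraMap k R (φ r) ∈ LinearMap.ker φ.toLinearMap := fun r => by
    simp [LinearMap.mem_ker]
  let κ : R →ₗ[k] (LinearMap.ker φ.toLinearMap) :=
    LinearMap.codRestrict (LinearMap.ker φ.toLinearMap)
      (LinearMap.id - (Algebra.linearMap k R).comp φ.toLinearMap) (fun r => hmem r)
  have hκ : ∀ r : R, ((κ r : LinearMap.ker φ.toLinearMap) : R) = r - algebraMap k R (φ r) :=
    fun r => rfl
  refine ⟨_, rfl, fun o => o.elim 1 (fun i => (bK i : R)), fun o => o.elim φ.toLinearMap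
    (fun i => (bK.coord i).comp κ), rfl, fun i => ?_, fun r => ?_⟩
  · exact LinearMap.mem_ker.mp (bK i).2
  · rw [Fintype.sum_option]
    simp only [Option.elim, AlgHom.toLinearMap_apply, LinearMap.comp_apply,
      Module.Basis.coord_apply]
    have hsum : ∑ i, (bK.repr (κ r)) i • ((bK i : LinearMap.ker φ.toLinearMap) : R) =
        ((κ r : LinearMap.ker φ.toLinearMap) : R) := by
      conv_rhs => rw [← bK.sum_repr (κ r)]
      rw [Submodule.coe_sum]
      rfl
    rw [hsum, hκ, Algebra.algebraMap_eq_smul_one]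
    abel

/-- **Depth kills long products.** If `(ker φ)^ν = 0` and `w₀ = 1`, `w_{i+1} ∈ ker φ`, then for a
choice function `c : Fin m → Option (Fin g)` taking at least `ν` non-unit values the product
`∏_i w_{c i}` vanishes. [folklore] -/
theorem prod_choice_eq_zero_of_depth {R : Type u} [CommRing R] [Algebra k R] (φ : R →ₐ[k] k)
    {ν : ℕ} (hν : (RingHom.ker φ) ^ ν = ⊥) {g : ℕ} (w : Option (Fin g) → R) (hw0 : w none = 1)
    (hw : ∀ i, φ (w (some i)) = 0) {m : ℕ} (c : Fin m → Option (Fin g))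
    (hc : ν ≤ (Finset.univ.filter fun i : Fin m => c i ≠ none).card) :
    ∏ i, w (c i) = 0 := by
  classical
  have h1 : ∏ i ∈ Finset.univ.filter (fun i : Fin m => c i ≠ none), w (c i) = ∏ i, w (c i) :=
    Finset.prod_filter_of_ne fun i _ hi => by
      intro hnone
      rw [hnone, hw0] at hi
      exact hi rfl
  have h2 : ∏ i ∈ Finset.univ.filter (fun i : Fin m => c i ≠ none), w (c i) ∈
      (RingHom.ker φ) ^ (Finset.univ.filter fun i : Fin m => c i ≠ none).card := by
    rw [← Finset.prod_const]
    refine Ideal.prod_mem_prod fun i hi => ?_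
    simp only [Finset.mem_filter, Finset.mem_univ, true_and] at hi
    obtain ⟨x, hx⟩ := Option.ne_none_iff_exists'.mp hi
    rw [hx, RingHom.mem_ker]
    exact hw x
  have h3 := Ideal.pow_le_pow_right hc h2
  rw [hν, Ideal.mem_bot] at h3
  rw [← h1, h3]

/-- **SEMISIMPLIFICATION BY ROW POLARIZATION (the depth axis).** Let `R` be a commutative
`k`-algebra, finite-dimensional, with a character `φ : R → k` whose kernel satisfies
`(ker φ)^ν = 0` (augmented of Loewy depth `≤ ν`; e.g. dual numbers `ν = 2`, the zeon algebra on
`n` generators `ν = n + 1`), and let `f = λ(det A)` coefficientwise for an `m × m` matrix `A` of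
affine forms over `R`.  Then `f` is a `k`-linear combination of at most
`Σ_{j<ν} C(m·g, j)` determinants of `m × m` AFFINE matrices over `k` itself, `g = dim ker φ =
dim R - 1`: expand every row of `A` in augmented coordinates `R = k·1 ⊕ ker φ`, use multilinearity
of `det` in the rows (`det_of_sum_mul_rows`), and note that a choice function picking `≥ ν` kernel
coordinates contributes `λ((ker φ)^ν) = 0` (`prod_choice_eq_zero_of_depth`).  Exact and
field-independent — the commutative-coefficient analogue of Bini's de-approximation of border
computations by interpolation. [cite: HrubesYehudayoff2011, §2] -/
theorem eq_sum_dets_of_depth {f : MvPolynomial σ k} {m : ℕ} {R : Type u} [CommRing R]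
    [Algebra k R] [Module.Finite k R] (φ : R →ₐ[k] k) {ν : ℕ} (hν : (RingHom.ker φ) ^ ν = ⊥)
    (l : R →ₗ[k] k) (A : Matrix (Fin m) (Fin m) (MvPolynomial σ R))
    (hA : ∀ i j, (A i j).totalDegree ≤ 1)
    (hf : ∀ d : σ →₀ ℕ, l (coeff d A.det) = coeff d f) :
    ∃ (G : ℕ) (α : Fin G → k) (B : Fin G → Matrix (Fin m) (Fin m) (MvPolynomial σ k)),
      G ≤ ∑ j ∈ Finset.range ν, (m * Module.finrank k (LinearMap.ker φ.toLinearMap)).choose j ∧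
        (∀ q i j, (B q i j).totalDegree ≤ 1) ∧ f = ∑ q, C (α q) * (B q).det := by
  classical
  obtain ⟨g, hg, w, π, hw0, hw, hspan⟩ := exists_augmentedCoords φ
  rw [← hg]
  -- coordinate matrices over `k`
  let B₀ : Option (Fin g) → Matrix (Fin m) (Fin m) (MvPolynomial σ k) := fun o i j =>
    (AddMonoidAlgebra.map (π o).toAddMonoidHom (A i j) : MvPolynomial σ k)
  have hB₀ : ∀ o i j, (B₀ o i j).totalDegree ≤ 1 := fun o i j =>
    (totalDegree_mapCoord_le (π o) (A i j)).trans (hA i j)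
  -- the entries of `A` in augmented coordinates
  have hentry : A = Matrix.of fun i j =>
      ∑ o, C (w o) * (MvPolynomial.map (algebraMap k R)).mapMatrix (B₀ o) i j := by
    ext i j d
    rw [Matrix.of_apply, coeff_sum]
    simp only [RingHom.mapMatrix_apply, Matrix.map_apply, coeff_C_mul, coeff_map]
    conv_lhs => rw [← hspan (coeff d (A i j))]
    refine Finset.sum_congr rfl fun o _ => ?_
    rw [Algebra.smul_def, mul_comm]
    rfl
  -- mixed matrices
  let Bc : (Fin m → Option (Fin g)) → Matrix (Fin m) (Fin m) (MvPolynomial σ k) := fun c =>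
    Matrix.of fun i j => B₀ (c i) i j
  have hBc : ∀ c i j, (Bc c i j).totalDegree ≤ 1 := fun c i j => hB₀ (c i) i j
  have hdet : A.det = ∑ c : Fin m → Option (Fin g),
      C (∏ i, w (c i)) * MvPolynomial.map (algebraMap k R) (Bc c).det := by
    rw [hentry, det_of_sum_mul_rows]
    refine Finset.sum_congr rfl fun c _ => ?_
    rw [map_prod, RingHom.map_det]
    rfl
  -- read through `λ`
  let F : (Fin m → Option (Fin g)) → MvPolynomial σ k := fun c => C (l (∏ i, w (c i))) * (Bc c).det
  have hfsum : f = ∑ c, F c := by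
    refine MvPolynomial.ext _ _ fun d => ?_
    rw [← hf d, hdet, coeff_sum, map_sum, coeff_sum]
    refine Finset.sum_congr rfl fun c _ => ?_
    rw [coeff_C_mul, coeff_map, coeff_C_mul, mul_comm, ← Algebra.smul_def, map_smul, smul_eq_mul,
      mul_comm]
  -- drop the deep choice functions
  let good : (Fin m → Option (Fin g)) → Prop := fun c =>
    (Finset.univ.filter fun q : Fin m × Fin g => c q.1 = some q.2).card < ν
  have hvanish : ∀ c, ¬ good c → F c = 0 := by
    intro c hc
    have hc' : ν ≤ (Finset.univ.filter fun i : Fin m => c i ≠ none).card := by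
      rw [card_support_eq_card_graphFinset]; exact not_lt.mp hc
    show C (l (∏ i, w (c i))) * (Bc c).det = 0
    rw [prod_choice_eq_zero_of_depth φ hν w hw0 hw c hc', map_zero, C_0, zero_mul]
  set s := Finset.univ.filter good with hs
  have hfsum' : f = ∑ c ∈ s, F c := by
    rw [hfsum, hs, Finset.sum_filter_of_ne]
    exact fun c _ hc => by_contra fun h => hc (hvanish c h)
  -- reindex by `Fin s.card`
  let e := s.equivFin
  refine ⟨s.card, fun q => l (∏ i, w ((e.symm q).1 i)), fun q => Bc (e.symm q).1, ?_, fun q i j =>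
    hBc _ i j, ?_⟩
  · exact card_shallowChoices_le m g ν
  · rw [hfsum', ← Finset.sum_coe_sort]
    exact Fintype.sum_equiv e (fun x => F x) _ fun x => by simp only [Equiv.symm_apply_apply, F]

/-- `dim ker φ ≤ dim R - 1` (the kernel of a character is a proper subspace: `φ 1 = 1`).
[folklore] -/
theorem finrank_ker_character_le {R : Type u} [CommRing R] [Algebra k R] [Module.Finite k R]
    (φ : R →ₐ[k] k) : Module.finrank k (LinearMap.ker φ.toLinearMap) ≤ Module.finrank k R - 1 := by
  have hne : LinearMap.ker φ.toLinearMap ≠ ⊤ := by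
    intro h
    have h1 : (1 : R) ∈ LinearMap.ker φ.toLinearMap := h ▸ Submodule.mem_top
    rw [LinearMap.mem_ker, AlgHom.toLinearMap_apply, map_one] at h1
    exact one_ne_zero h1
  have := Submodule.finrank_lt hne
  omega

/-- **Semisimplification with the clean count.** Under the hypotheses of `eq_sum_dets_of_depth`
and `dim R ≤ s`, `f` is a linear combination of at most `(m (s - 1) + 1)^(ν - 1)` affine `m × m`
determinants over `k`.  Depth `ν = 2` (square-zero augmentation ideal, e.g. dual numbers, where
`per_n = α det A + β tr(adj A · A′)`): `m (s - 1) + 1` determinants of size `m`.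
[cite: HrubesYehudayoff2011, §2] -/
theorem eq_sum_dets_of_depth_le {f : MvPolynomial σ k} {m s : ℕ} {R : Type u}
    [CommRing R] [Algebra k R] [Module.Finite k R] (φ : R →ₐ[k] k) {ν : ℕ}
    (hν : (RingHom.ker φ) ^ ν = ⊥) (hs : Module.finrank k R ≤ s) (l : R →ₗ[k] k)
    (A : Matrix (Fin m) (Fin m) (MvPolynomial σ R)) (hA : ∀ i j, (A i j).totalDegree ≤ 1)
    (hf : ∀ d : σ →₀ ℕ, l (coeff d A.det) = coeff d f) :
    ∃ (G : ℕ) (α : Fin G → k) (B : Fin G → Matrix (Fin m) (Fin m) (MvPolynomial σ k)),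
      G ≤ (m * (s - 1) + 1) ^ (ν - 1) ∧ (∀ q i j, (B q i j).totalDegree ≤ 1) ∧
        f = ∑ q, C (α q) * (B q).det := by
  obtain ⟨G, α, B, hG, hB, hfB⟩ := eq_sum_dets_of_depth φ hν l A hA hf
  have hg : Module.finrank k (LinearMap.ker φ.toLinearMap) ≤ s - 1 :=
    (finrank_ker_character_le φ).trans (Nat.sub_le_sub_right hs 1)
  have hG' : G ≤ (m * (s - 1) + 1) ^ (ν - 1) := by
    refine hG.trans ((Finset.sum_le_sum fun j _ => Nat.choose_le_choose j
      (Nat.mul_le_mul_left m hg)).trans (sum_range_choose_le_pow _ _))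
  exact ⟨G, α, B, hG', hB, hfB⟩

end Semisimplification

end Summit.ValiantsHypothesis.ValiantsHypothesis.Theorems.GrenetZeonPolySizeQPAlgebra

end
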